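import Literature.AlgebraicGeometry.Resolution.AlterationsLemma411Projection
import Literature.AlgebraicGeometry.Resolution.MvPolynomialKillVars
import Literature.AlgebraicGeometry.Motives.SegreEmbedding
import HarnessLib

/-!
# De Jong's alteration theorem: the generic part of Lemma 4.11, normalised at the vertex

Topic: `Literature/AlgebraicGeometry/Resolution`. Seventh layer under `AlterationsInduction.lean`,
decomposing the named fact `DeJong1996Lemma411GenericProjection` of
`AlterationsLemma411Projection.lean` — the GENERIC part of the printed proof of de Jong 1996,
Lemma 4.11 (p. 68), everything in it that is not the three construction facts of that file:

> "There exists a finite morphism `π : X → ℙ^d` which is étale over an open subset of `ℙ^d`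
> and such that `π|_Z : Z → π(Z)` is birational. To construct such a `π`, we choose an
> embedding `X ↪ ℙ^N` and we let `π` be the composition of projection morphisms as in 2.11,
> adapted to `Z` and `X`. Let `B ⊂ ℙ^d` be the branch locus of `π` […]. Therefore, for a
> general point `p ∈ ℙ^d`, `p ∉ B ∪ π(Z)`, the morphism `pr_p : π(Z) → ℙ^{d-1}` is étale over
> a nonempty open subscheme of `ℙ^{d-1}`. See 2.11. Choose `p` and put
> `X' = {(x, ℓ) ∈ X × ℙ^{d-1} | π(x) ∈ ℓ}`. […] Locally in the étale topology, `f` along `E_i`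
> looks like `pr_p : P̃^d → ℙ^{d-1}` along the exceptional fibre of the blowing up `P̃^d → ℙ^d`
> of `ℙ^d` in `p`. […] Assertion (ii) c) is clear as `Z' ≅ Z → π(Z) → ℙ^{d-1}` is generically
> étale by construction. To prove the last assertion, we go back to the method whereby we
> constructed `π`. […] By the usual Bertini arguments we see that choosing `L` and `p`
> general gives that there is at least one `H` such that the curve `X ∩ H` is smooth over `k`."

As in the two files above, `dim X = d + 1` and the paper's `ℙ^d`, `ℙ^{d-1}` are `ℙ^{d+1}_k`,
`ℙ^d_k` (`Literature.AlgebraicGeometry.Motives.projectiveSpace`). The fact is cut into the one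
place where auxiliary schemes are CONSTRUCTED — the blowing up `b : P̃ → ℙ^{d+1}` of `ℙ^{d+1}_k`
in the point `p` together with the linear projection `q = pr_p : P̃ → ℙ^d` made a morphism
(classically the incidence variety `{(y, ℓ) | y ∈ ℓ} ⊂ ℙ^{d+1} × ℙ^d` of points and lines
through `p`: "the blow-up is the graph of the rational map `π_Λ : ℙ^n ⇢ ℙ^{n-r}` given by
projection from `Λ`", a `ℙ¹`-bundle over `ℙ^d`, Eisenbud–Harris, *3264 and All That*, §9.3.2
and Prop. 9.11 with `r = 1`) — and the CHOICE of `π` and `p` (2.11 (α), (β) iterated and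
"adapted to `Z` and `X`", `p ∉ B ∪ π(Z)`, "(ii) c) … by construction", Bertini for d)).

NORMALISATION AT THE VERTEX. In the paper `p` is a general point of `ℙ^{d+1}`. The admissible
`p` form a dense open set, and composing `π` with a projective linear transformation `g` of
`ℙ^{d+1}_k` with `g(p) = (0 : … : 0 : 1)` — which carries the lines through `p` to the lines
through `(0 : … : 0 : 1)`, conjugates `pr_p` into `pr_{(0:…:0:1)}`, and preserves everything
asked of `π` — one may take for `p` the VERTEX `(0 : … : 0 : 1) = V₊(x₀, …, x_d)` of the
coordinate simplex, for which `pr_p` is the coordinate projection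
`(x₀ : … : x_{d+1}) ↦ (x₀ : … : x_d)`, regular on `ℙ^{d+1} ∖ {p} = ⋃_{i ≤ d} D₊(x_i)`. This turns
the linear projection into a concrete object although neither linear subspaces of `Proj` nor
rational maps between projective spaces are available: on the chart
`D₊(x_i) = Spec (k[x]_{(x_i)})₀`, `i ≤ d`, it is `Spec` of the ring map `y_a/y_i ↦ x_a/x_i`
followed by the chart `D₊(y_i) ↪ ℙ^d_k`.

* `DeJong1996.vertex d k` — the point `(0 : … : 0 : 1) ∈ ℙ^{d+1}_k`, i.e. the relevant
  homogeneous prime `(x₀, …, x_d) ⊂ k[x₀, …, x_{d+1}]` (`vertexIdeal`).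
* `DeJong1996.vertexProjectionChart d k i` (`i : Fin (d + 1)`) — the linear projection from
  the vertex on the chart `D₊(x_i) ⊂ ℙ^{d+1}_k`, `Spec (k[x]_{(x_i)})₀ → ℙ^d_k`: `Spec` of
  `vertexProjectionRingHom d k i : (k[y]_{(y_i)})₀ → (k[x]_{(x_i)})₀`, `y_a/y_i ↦ x_a/x_i`
  (`vertexProjectionRingHom_frac`), followed by Mathlib's chart `Proj.awayι`
  (`Literature.AlgebraicGeometry.Motives.Segre.chartι`); a morphism over `k`
  (`vertexProjectionChart_toSpec`).
* `DeJong1996.IsVertexProjection d k b q` — "`q : P̃ → ℙ^d` is the linear projection from the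
  vertex through `b : P̃ → ℙ^{d+1}`": over every chart `D₊(x_i)`, `i ≤ d`, the restriction of
  `q` to `b⁻¹ D₊(x_i)` is `b` followed by `vertexProjectionChart d k i` (stated on the fibre
  product `P̃ ×_{ℙ^{d+1}} D₊(x_i)`). Together with
  `DeJong1996.PointBlowupProjection d k (vertex d k) b q` of `AlterationsLemma411Projection.lean`
  (`b` is the blowing up in the vertex; `q` is a smooth `k`-morphism with irreducible fibres of
  dimension `≤ 1`, each met by `E = b⁻¹(vertex)`) this determines `(P̃, b, q)` up to unique
  isomorphism: `b` by the universal property of blowing up, and `q` because it is prescribed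
  on `b⁻¹(ℙ^{d+1} ∖ {vertex}) = P̃ ∖ E`, the complement of an effective Cartier divisor, which
  is schematically dense (and `ℙ^d` is separated); so quantifying over all such triples, as the
  second fact does, is quantifying over the incidence variety.
* `DeJong1996VertexBlowupProjection` — NAMED FACT (de Jong p. 68 with Eisenbud–Harris
  Prop. 9.11): the blowing up of `ℙ^{d+1}_k` in the vertex, with its projection to `ℙ^d_k`,
  exists and has the properties `PointBlowupProjection` and `IsVertexProjection`.
* `DeJong1996Lemma411VertexChoice` — NAMED FACT (de Jong p. 68: ¶ 1–2 of the proof with 2.11,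
  "(ii) c) is clear … by construction", and the Bertini paragraph), normalised at the vertex:
  under the hypotheses of 4.11 there is `π` as in `DeJong1996.Lemma411Projection` with
  `p = vertex` such that for every `(P̃, b, q)` as above the two generic conclusions of
  `DeJong1996Lemma411GenericProjection` hold verbatim.
* PROVED: `DeJong1996Lemma411GenericProjection.of_vertexBlowupProjection_of_vertexChoice` — the
  two facts imply `DeJong1996Lemma411GenericProjection` (with `p` the vertex); rewired down to
  `DeJong1996Lemma411` and `DeJong1996StrongAlgClosed`.

Deliberately NOT here (the inputs of the two facts): the construction of `(P̃, b, q)` — the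
blowing up exists (`BlowupsExistence.lean`) and `q` is the morphism to `ℙ^d` of the sections
`b^* x₀, …, b^* x_d` generating the invertible ideal `𝓘_E ⊗ b^*𝒪(1)`
(`BlowupGeneratingSections.lean`, `Motives/MorphismsToProjectiveSpace.lean`), its smoothness
and its fibres (the lines through the vertex); generic linear projections, de Jong 2.11 (α),
(β) (Noether normalisation in projective form with generic étaleness, and birationality of
`π|_Z`), the identification `f|_{Z'} = pr_p ∘ π|_Z`, and Bertini's theorem
(Hartshorne II 8.18), for `DeJong1996Lemma411VertexChoice`.

## Sources

* A. J. de Jong, *Smoothness, semi-stability and alterations*, Publ. Math. IHÉS 83 (1996)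
  51–93: 2.11 (p. 56), Lemma 4.11 (p. 67) and its proof (p. 68). [DeJong1996]
* D. Eisenbud, J. Harris, *3264 and All That* (2016), §9.3.2 and Prop. 9.11 (the blow-up of
  `ℙ^n` along a linear space `Λ ≅ ℙ^{r-1}`, with its projection to `ℙ^{n-r}`, is the projective
  bundle `ℙ(𝒪(-1) ⊕ V' ⊗ 𝒪) → ℙ^{n-r}`; it is the graph of the projection from `Λ`).
  [EisenbudHarris2016]
* R. Hartshorne, *Algebraic Geometry* (1977), II Thm. 8.18 (Bertini). [Hartshorne1977]
-/

noncomputable section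

open CategoryTheory CategoryTheory.Limits AlgebraicGeometry TopologicalSpace HomogeneousLocalization

attribute [local instance] MvPolynomial.gradedAlgebra

namespace Literature.AlgebraicGeometry.Resolution

universe u

open Literature.AlgebraicGeometry.Motives (projectiveSpace IsProjectiveOver)
open Literature.AlgebraicGeometry.Motives.Segre (grading cst frac chartι toSpec X_mem val_cst
  val_frac frac_self chartι_toSpec)

namespace DeJong1996

variable (d : ℕ) (k : Type u) [Field k]

/-! ## The vertex `(0 : … : 0 : 1) ∈ ℙ^{d+1}_k` -/

/-- The homogeneous ideal `(x₀, …, x_d) ⊂ k[x₀, …, x_{d+1}]` of the vertex `(0 : … : 0 : 1)` of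
the coordinate simplex of `ℙ^{d+1}_k` (generated by variables, hence homogeneous). [folklore] -/
def vertexIdeal : HomogeneousIdeal (grading (Fin (d + 1 + 1)) k) :=
  ⟨Ideal.span (MvPolynomial.X '' Set.range (Fin.castSucc : Fin (d + 1) → Fin (d + 1 + 1))),
    Ideal.homogeneous_span _ _ fun f hf => by
      obtain ⟨i, -, rfl⟩ := hf
      exact ⟨1, X_mem k i⟩⟩

/-- Unfolding `vertexIdeal`. [folklore] -/
theorem toIdeal_vertexIdeal : (vertexIdeal d k).toIdeal =
    Ideal.span (MvPolynomial.X '' Set.range (Fin.castSucc : Fin (d + 1) → Fin (d + 1 + 1))) :=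
  rfl

/-- The last variable `x_{d+1}` does not vanish at the vertex: `x_{d+1} ∉ (x₀, …, x_d)`.
[folklore] -/
theorem X_last_notMem_vertexIdeal :
    (MvPolynomial.X (Fin.last (d + 1)) : MvPolynomial (Fin (d + 1 + 1)) k) ∉
      (vertexIdeal d k).toIdeal := by
  rw [toIdeal_vertexIdeal]
  refine MvPolynomial.X_not_mem_span_X (R := k) _ ?_
  rintro ⟨j, hj⟩
  exact (Fin.castSucc_lt_last j).ne hj

/-- The variables `x_i`, `i ≤ d`, vanish at the vertex: `x_i ∈ (x₀, …, x_d)`. [folklore] -/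
theorem X_castSucc_mem_vertexIdeal (i : Fin (d + 1)) :
    (MvPolynomial.X (Fin.castSucc i) : MvPolynomial (Fin (d + 1 + 1)) k) ∈
      (vertexIdeal d k).toIdeal :=
  Ideal.subset_span ⟨Fin.castSucc i, ⟨i, rfl⟩, rfl⟩

/-- **The vertex `p = (0 : … : 0 : 1) ∈ ℙ^{d+1}_k`**, the point of
`Proj k[x₀, …, x_{d+1}] = (projectiveSpace (d + 1) k).left` (written in the `Proj` spelling, to
which the latter reduces by `rfl`) given by the relevant homogeneous prime `(x₀, …, x_d)` (prime
since `k[x]/(x₀, …, x_d) ≅ k[x_{d+1}]` is a domain; relevant since `x_{d+1} ∉ (x₀, …, x_d)`). It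
plays the part of the general point `p ∈ ℙ^d` of de Jong 1996, proof of 4.11, after a linear
change of coordinates (see the module docstring). [cite: DeJong1996, Lemma 4.11 (proof), p. 68] -/
def vertex : Proj (grading (Fin (d + 1 + 1)) k) where
  asHomogeneousIdeal := vertexIdeal d k
  isPrime := (Ideal.Quotient.isDomain_iff_prime _).mp
    (MvPolynomial.isDomain_quotient_span_X (R := k) _)
  not_irrelevant_le h := X_last_notMem_vertexIdeal d k
    (h (HomogeneousIdeal.mem_irrelevant_of_mem _ zero_lt_one (X_mem k (Fin.last (d + 1)))))

/-- The homogeneous prime of the vertex is `(x₀, …, x_d)` (unfolding). [folklore] -/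
theorem vertex_asHomogeneousIdeal : (vertex d k).asHomogeneousIdeal = vertexIdeal d k :=
  rfl

/-- The vertex lies outside every chart `D₊(x_i)`, `i ≤ d` (the `x_i`, `i ≤ d`, vanish at it),
so that the charts `D₊(x_i)`, `i ≤ d`, on which the projection from the vertex is defined below,
lie in `ℙ^{d+1} ∖ {vertex}`. [folklore] -/
theorem vertex_notMem_basicOpen (i : Fin (d + 1)) :
    vertex d k ∉
      Proj.basicOpen (grading (Fin (d + 1 + 1)) k) (MvPolynomial.X (Fin.castSucc i)) := by
  rw [Proj.mem_basicOpen]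
  exact fun h => h (X_castSucc_mem_vertexIdeal d k i)

/-- The vertex lies in the last chart `D₊(x_{d+1})`. [folklore] -/
theorem vertex_mem_basicOpen_last :
    vertex d k ∈
      Proj.basicOpen (grading (Fin (d + 1 + 1)) k) (MvPolynomial.X (Fin.last (d + 1))) := by
  rw [Proj.mem_basicOpen]
  exact X_last_notMem_vertexIdeal d k

/-! ## The linear projection from the vertex, chart by chart -/

/-- The ring map `k[y₀, …, y_d] → (k[x]_{(x_i)})₀`, `y_a ↦ x_a/x_i`, `i ≤ d` (constants to
constants): the coordinate projection `(x₀ : … : x_{d+1}) ↦ (x₀ : … : x_d)` read on the chart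
`D₊(x_i)` of `ℙ^{d+1}_k`. [folklore] -/
def vertexProjectionFun (i : Fin (d + 1)) :
    MvPolynomial (Fin (d + 1)) k →+*
      Away (grading (Fin (d + 1 + 1)) k) (MvPolynomial.X (Fin.castSucc i)) :=
  MvPolynomial.eval₂Hom (cst k (MvPolynomial.X (Fin.castSucc i)))
    fun a => frac k (Fin.castSucc i) (Fin.castSucc a)

/-- `vertexProjectionFun` on variables: `y_a ↦ x_a/x_i`. [folklore] -/
@[simp]
theorem vertexProjectionFun_X (i a : Fin (d + 1)) :
    vertexProjectionFun d k i (MvPolynomial.X a) = frac k (Fin.castSucc i) (Fin.castSucc a) := by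
  simp [vertexProjectionFun]

/-- `vertexProjectionFun` on constants. [folklore] -/
@[simp]
theorem vertexProjectionFun_C (i : Fin (d + 1)) (c : k) :
    vertexProjectionFun d k i (MvPolynomial.C c) = cst k (MvPolynomial.X (Fin.castSucc i)) c := by
  simp [vertexProjectionFun]

/-- `y_i ↦ x_i/x_i = 1` is a unit, so `vertexProjectionFun` extends to `(k[y]_{(y_i)})₀`.
[folklore] -/
theorem isUnit_vertexProjectionFun_X_self (i : Fin (d + 1)) :
    IsUnit (vertexProjectionFun d k i (MvPolynomial.X i)) := by
  rw [vertexProjectionFun_X, frac_self]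
  exact isUnit_one

/-- **The linear projection from the vertex on the rings of the charts**:
`(k[y]_{(y_i)})₀ → (k[x]_{(x_i)})₀`, `y_a/y_i ↦ x_a/x_i` (`i ≤ d`), i.e. the comorphism of
`pr_{vertex} : D₊(x_i) → D₊(y_i)`, `(x₀ : … : x_{d+1}) ↦ (x₀ : … : x_d)`. [folklore] -/
def vertexProjectionRingHom (i : Fin (d + 1)) :
    Away (grading (Fin (d + 1)) k) (MvPolynomial.X i) →+*
      Away (grading (Fin (d + 1 + 1)) k) (MvPolynomial.X (Fin.castSucc i)) :=
  (Localization.awayLift (vertexProjectionFun d k i) (MvPolynomial.X i)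
      (isUnit_vertexProjectionFun_X_self d k i)).comp
    (algebraMap _ (Localization.Away (MvPolynomial.X i : MvPolynomial (Fin (d + 1)) k)))

/-- `vertexProjectionRingHom` is a `k`-algebra map. [folklore] -/
theorem vertexProjectionRingHom_comp_cst (i : Fin (d + 1)) :
    (vertexProjectionRingHom d k i).comp (cst k (MvPolynomial.X i)) =
      cst k (MvPolynomial.X (Fin.castSucc i)) := by
  refine RingHom.ext fun c => ?_
  simp only [vertexProjectionRingHom, RingHom.comp_apply, HomogeneousLocalization.algebraMap_apply,
    val_cst]
  rw [IsLocalization.Away.lift_eq]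
  exact vertexProjectionFun_C d k i c

/-- **`y_a/y_i ↦ x_a/x_i`** under `vertexProjectionRingHom`. [folklore] -/
theorem vertexProjectionRingHom_frac (i a : Fin (d + 1)) :
    vertexProjectionRingHom d k i (frac k i a) = frac k (Fin.castSucc i) (Fin.castSucc a) := by
  have hv : vertexProjectionFun d k i (MvPolynomial.X i) * 1 = 1 := by
    rw [mul_one, vertexProjectionFun_X, frac_self]
  simp only [vertexProjectionRingHom, RingHom.comp_apply, HomogeneousLocalization.algebraMap_apply,
    val_frac]
  rw [Localization.awayLift_mk (vertexProjectionFun d k i) (MvPolynomial.X i) _ 1 hv 1, one_pow,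
    mul_one, pow_one, vertexProjectionFun_X]

/-- **The linear projection from the vertex on the chart `D₊(x_i)`, `i ≤ d`**:
`pr_{vertex} : Spec (k[x]_{(x_i)})₀ = D₊(x_i) → D₊(y_i) ↪ ℙ^d_k`,
`(x₀ : … : x_{d+1}) ↦ (x₀ : … : x_d)` — the morphism `pr_p` of de Jong 1996, proof of 4.11, for
`p` the vertex, on the standard charts covering `ℙ^{d+1} ∖ {p}`.
[cite: DeJong1996, Lemma 4.11 (proof), p. 68] -/
def vertexProjectionChart (i : Fin (d + 1)) :
    Spec (.of (Away (grading (Fin (d + 1 + 1)) k) (MvPolynomial.X (Fin.castSucc i)))) ⟶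
      Proj (grading (Fin (d + 1)) k) :=
  Spec.map (CommRingCat.ofHom (vertexProjectionRingHom d k i)) ≫ chartι k i

/-- The chart projection is a morphism over `k`: composed with the structure morphism
`ℙ^d_k → Spec k` (`Segre.toSpec`, which is `(projectiveSpace d k).hom` by `rfl`,
`projectiveSpace_hom_eq_toSpec`) it is the structure morphism `Spec (k[x]_{(x_i)})₀ → Spec k`.
[folklore] -/
theorem vertexProjectionChart_toSpec (i : Fin (d + 1)) :
    vertexProjectionChart d k i ≫ toSpec (Fin (d + 1)) k =
      Spec.map (CommRingCat.ofHom (cst k (MvPolynomial.X (Fin.castSucc i)))) := by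
  rw [vertexProjectionChart, Category.assoc, chartι_toSpec, ← Spec.map_comp,
    ← CommRingCat.ofHom_comp, vertexProjectionRingHom_comp_cst]

/-- **"`q : P̃ → ℙ^d` is the linear projection from the vertex through `b : P̃ → ℙ^{d+1}`"**
(de Jong 1996, proof of 4.11: `X' = {(x, ℓ) | π(x) ∈ ℓ}`, `f = pr₂`, and `f` "looks like
`pr_p : P̃^d → ℙ^{d-1}`"): over each chart `D₊(x_i)`, `i ≤ d`, of `ℙ^{d+1} ∖ {vertex}`, the
morphism `q` restricted to `b⁻¹ D₊(x_i) = P̃ ×_{ℙ^{d+1}} D₊(x_i)` is `b` followed by the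
projection `vertexProjectionChart d k i`. Since `b` is an isomorphism over
`ℙ^{d+1} ∖ {vertex} = ⋃_{i ≤ d} D₊(x_i)` when it is the blowing up in the vertex, this says that
`q` extends `pr_{vertex} ∘ b`. [cite: DeJong1996, Lemma 4.11 (proof), p. 68] -/
structure IsVertexProjection {P : Scheme.{u}} (b : P ⟶ (projectiveSpace (d + 1) k).left)
    (q : P ⟶ (projectiveSpace d k).left) : Prop where
  /-- on `b⁻¹ D₊(x_i)`, `i ≤ d`: `q = pr_{vertex} ∘ b` -/
  pullback_fst_comp : ∀ i : Fin (d + 1),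
    pullback.fst b (chartι k (Fin.castSucc i)) ≫ q =
      pullback.snd b (chartι k (Fin.castSucc i)) ≫ vertexProjectionChart d k i

end DeJong1996

/-! ## The two named facts -/

/-- NAMED FACT — **the blowing up of `ℙ^{d+1}_k` in the vertex with its projection to `ℙ^d_k`**
(de Jong 1996, proof of 4.11: "`X' = {(x, ℓ) ∈ X × ℙ^{d-1} | π(x) ∈ ℓ}` […] equals the blowing
up of `X` in the finite set `π⁻¹(p)`" — for `X = ℙ^d`, `π = id` —, "`f = pr₂`", and "Locally in
the étale topology, `f` along `E_i` looks like `pr_p : P̃^d → ℙ^{d-1}` along the exceptional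
fibre of the blowing up `P̃^d → ℙ^d` of `ℙ^d` in `p`"; Eisenbud–Harris Prop. 9.11 with `r = 1`:
the blow-up of `ℙ^n` in a point, with its projection to `ℙ^{n-1}`, is the `ℙ¹`-bundle
`ℙ(𝒪(-1) ⊕ 𝒪) → ℙ^{n-1}`, the graph of the projection from the point). Rendered for the vertex
`p = (0 : … : 0 : 1)` of `ℙ^{d+1}_k`, `k` algebraically closed as in 4.11: there are a scheme
`P̃`, `b : P̃ → ℙ^{d+1}_k` and `q : P̃ → ℙ^d_k` with `DeJong1996.PointBlowupProjection` (`p` is a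
closed point, `b` is a blowing up in `p`, `q` is a smooth `k`-morphism all of whose fibres are
irreducible of dimension `≤ 1` and meet `E = b⁻¹(p)`) and `DeJong1996.IsVertexProjection`
(`q = pr_p ∘ b` off `E`). Users take `(h : DeJong1996VertexBlowupProjection)`.
[cite: DeJong1996, Lemma 4.11 (proof), p. 68] -/
def DeJong1996VertexBlowupProjection : Prop :=
  ∀ (k : Type u) [Field k] [IsAlgClosed k] (d : ℕ),
    ∃ (P : Scheme.{u}) (b : P ⟶ (projectiveSpace (d + 1) k).left)
      (q : P ⟶ (projectiveSpace d k).left),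
      DeJong1996.PointBlowupProjection d k (DeJong1996.vertex d k) b q ∧
        DeJong1996.IsVertexProjection d k b q

/-- NAMED FACT — **de Jong 1996, proof of Lemma 4.11: the choice of `π` and `p`, normalised at
the vertex** (2.11 iterated and "adapted to `Z` and `X`"; "for a general point `p ∈ ℙ^d`,
`p ∉ B ∪ π(Z)`, the morphism `pr_p : π(Z) → ℙ^{d-1}` is étale over a nonempty open subscheme of
`ℙ^{d-1}`. See 2.11. Choose `p`"; "Assertion (ii) c) is clear as `Z' ≅ Z → π(Z) → ℙ^{d-1}` is
generically étale by construction"; "By the usual Bertini arguments we see that choosing `L`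
and `p` general gives that there is at least one `H` such that the curve `X ∩ H` is smooth over
`k`"). Suppose `(X, Z)` over the algebraically closed field `k` satisfies (ii)–(iv) of 4.6–4.8
(`X` a projective variety, `Z` the support of an effective Cartier divisor) and
`dim X = d + 1`. Then — after the linear change of coordinates on `ℙ^{d+1}` moving the chosen
general point `p` to the vertex `(0 : … : 0 : 1)`, see the module docstring — there is
`π : X → ℙ^{d+1}_k` as in `DeJong1996.Lemma411Projection` for `p = DeJong1996.vertex d k` (a
finite surjective `k`-morphism, étale over a neighbourhood of `p`, `p ∉ π(Z)`) such that for
EVERY blowing up `b : P̃ → ℙ^{d+1}` in `p` with projection `q : P̃ → ℙ^d` from `p`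
(`DeJong1996.PointBlowupProjection`, `DeJong1996.IsVertexProjection`; these determine
`(P̃, b, q)` up to unique isomorphism), writing `X' = X ×_{ℙ^{d+1}} P̃`, `φ = pr₁`,
`f = pr₂ ≫ q`: (ii) c) `f|_{φ⁻¹Z}` is finite and generically étale
(`DeJong1996.IsFiniteGenericallyEtaleOn`), and d) if `X` is normal, the fibre of `f` at some
`y ∈ ℙ^d` is smooth over `κ(y)` — literally the last two conclusions of
`DeJong1996Lemma411GenericProjection`. Inputs of the printed proof: generic linear projections
(2.11 (α), (β)), the identification of `f|_{Z'}` with `pr_p ∘ π|_Z` (`φ` is an isomorphism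
near `Z`), of the fibres of `f` with the linear sections `π⁻¹(ℓ) = X ∩ H`, and Bertini's
theorem. Users take `(h : DeJong1996Lemma411VertexChoice)`.
[cite: DeJong1996, Lemma 4.11 (proof), p. 68] -/
def DeJong1996Lemma411VertexChoice : Prop :=
  ∀ (k : Type u) [Field k] [IsAlgClosed k] (X : Scheme.{u}) (fX : X ⟶ Spec (.of k)) (Z : Set X)
    (d : ℕ), IsIntegral X → IsProjectiveOver (Over.mk fX) →
      (∃ D : X.IdealSheafData, IsEffectiveCartier D ∧ (D.support : Set X) = Z) →
        topologicalKrullDim X = (d + 1 : ℕ) →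
          ∃ π : X ⟶ (projectiveSpace (d + 1) k).left,
            DeJong1996.Lemma411Projection fX Z d π (DeJong1996.vertex d k) ∧
              ∀ (P : Scheme.{u}) (b : P ⟶ (projectiveSpace (d + 1) k).left)
                (q : P ⟶ (projectiveSpace d k).left),
                DeJong1996.PointBlowupProjection d k (DeJong1996.vertex d k) b q →
                  DeJong1996.IsVertexProjection d k b q →
                    DeJong1996.IsFiniteGenericallyEtaleOn (pullback.snd π b ≫ q)
                        ((pullback.fst π b) ⁻¹' Z) ∧
                      ((∀ x : X, IsIntegrallyClosed (X.presheaf.stalk x)) →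
                        ∃ y : ↥(projectiveSpace d k).left,
                          Smooth ((pullback.snd π b ≫ q).fiberToSpecResidueField y))

/-! ## The assembly -/

/-- **`DeJong1996Lemma411GenericProjection` from the two facts of this file**: take `π` from
`DeJong1996Lemma411VertexChoice`, `p` the vertex, and `(P̃, b, q)` from
`DeJong1996VertexBlowupProjection`. [cite: DeJong1996, Lemma 4.11 (proof), p. 68] -/
theorem DeJong1996Lemma411GenericProjection.of_vertexBlowupProjection_of_vertexChoice
    (h₁ : DeJong1996VertexBlowupProjection.{u}) (h₂ : DeJong1996Lemma411VertexChoice.{u}) :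
    DeJong1996Lemma411GenericProjection.{u} := by
  intro k _ _ X fX Z d hint hX hZ hdim
  obtain ⟨π, hπ, h⟩ := h₂ k X fX Z d hint hX hZ hdim
  obtain ⟨P, b, q, hM, hV⟩ := h₁ k d
  obtain ⟨hc, hd⟩ := h P b q hM hV
  exact ⟨π, DeJong1996.vertex d k, P, b, q, hπ, hM, hc, hd⟩

/-- **de Jong 1996, Lemma 4.11** from the two facts of this file and the three construction
facts of `AlterationsLemma411Projection.lean`. [cite: DeJong1996, Lemma 4.11, pp. 67–68] -/
theorem DeJong1996Lemma411.of_vertexBlowupProjection_of_vertexChoice_of_construction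
    (h₁ : DeJong1996VertexBlowupProjection.{u}) (h₂ : DeJong1996Lemma411VertexChoice.{u})
    (hB₁ : DeJong1996Lemma411Blowup.{u}) (hB₂ : DeJong1996Lemma411FibreDimension.{u})
    (hB₃ : DeJong1996Lemma411SmoothLocusDense.{u}) : DeJong1996Lemma411.{u} :=
  DeJong1996Lemma411.of_genericProjection_of_construction
    (DeJong1996Lemma411GenericProjection.of_vertexBlowupProjection_of_vertexChoice h₁ h₂)
    hB₁ hB₂ hB₃

/-- **Thm. 4.1 with its generically-étale clause over algebraically closed fields** from the
projectivity of blowing ups, the two facts of this file, the three construction facts of 4.11,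
the two inputs of 4.12 and 4.13–4.28. [cite: DeJong1996, 4.3–4.12, pp. 66–69] -/
theorem DeJong1996StrongAlgClosed.of_blowupProjective_of_vertexChoice_of_construction_of_stepVI
    (hB : BlowupProjectiveOverField.{u}) (h₁ : DeJong1996VertexBlowupProjection.{u})
    (h₂ : DeJong1996Lemma411VertexChoice.{u}) (hB₁ : DeJong1996Lemma411Blowup.{u})
    (hB₂ : DeJong1996Lemma411FibreDimension.{u}) (hB₃ : DeJong1996Lemma411SmoothLocusDense.{u})
    (h28 : DeJong1996SmoothOverOpen.{u}) (hc : DeJong1996FibresGeometricallyConnected.{u})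
    (h₂' : DeJong1996NormalProjectiveStepVI.{u}) : DeJong1996StrongAlgClosed.{u} :=
  DeJong1996StrongAlgClosed.of_blowupProjective_of_genericProjection_of_construction_of_stepVI hB
    (DeJong1996Lemma411GenericProjection.of_vertexBlowupProjection_of_vertexChoice h₁ h₂)
    hB₁ hB₂ hB₃ h28 hc h₂'

end Literature.AlgebraicGeometry.Resolution

end
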